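import Literature.NumberTheory.EllipticCurves.IwasawaAlgebraEisensteinTorsionExactProofs
import Literature.NumberTheory.GaloisRepresentations.DiscreteGaloisModuleDivision
import HarnessLib

/-!
# The two-index maps of the Eisenstein tower: iterated reductions `W_a ↠ W_b` and divisions `×p^{b−a} : W_a ↪ W_b`,
# with the short exact sequences `0 → W_ℓ → W_{ℓ+n} → W_n → 0` (definitions with bodies + theorems; no named fact,
# no instance, no notation)

Topic `NumberTheory/EllipticCurves` (D1 road of cell `pub/bsd-print-x9`; sequel to `ZpExtensionEisensteinAdicTower`
(the tower `k ↦ W_k = M_k ⊗ A_{m,k}(ψ)` = `T_𝔮/p^k T_𝔮`) and `ZpExtensionEisensteinTowerExactProofs` (one-step exactness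
`ker(W_{k+1} → W_k) = p^k W_{k+1}`); the MODULE-LEVEL input of the cohomological hypotheses (L)/(E) of H.3 for the
saturated `F_𝔮` (`TowerSaturatedCartesianPresentedProofs`, x10b-p1-w7; `HOME/p1/H3-CARTESIAN-PLAN`), in the shape agreed
on the cell's STATUS 2026-08-28 16:43Z).

For the abstract D1 tower (`M : ℕ → Type`, transitions `t k : M_{k+1} → M_k` surjective with `ker t_k = p^k M_{k+1}`,
levels killed by `p^k` and FREE over `ℤ/p^k`, e.g. `M_k = E[p^k]` with `×p`), the Eisenstein levels
`W_k = κ.eisensteinTwist (ρ k) hm k` (`M_k ⊗ A_{m,k}(ψ)`) carry ONE total two-index family of continuous equivariant maps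

  `eisensteinTwistTransfer … a b : W_a →ⁱL W_b` — for `b ≤ a` the iterated reduction `c ⊗ x ↦ (c mod p^b) ⊗ t^{a−b} x`
  (`eisensteinTwistReduce` along `transitionIter`), for `a < b` the DIVISION `×p^{b−a}`: the unique additive map `g` with
  `g ∘ red_{b→a} = p^{b−a} • id` (`divIntertwining`, from surjectivity and `p^{b−a} • ker = 0`),

i.e. the maps `T/p^a T → T/p^b T` induced by the identity (`b ≤ a`) and by `×p^{b−a}` (`a < b`) on `T = T_𝔮`, with:
`_succ_self` (`F (j+1) j = eisensteinTwistReduce hm (Nat.le_succ j) (t j)`), `_self` (`F a a = id`), `_comp` (reductions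
compose), `_sq` (`×p^{b−a}` commutes with one reduction step), the ROWS `_injective` (`F ℓ (ℓ+n)`), `_surjective`
(`F (ℓ+n) n`), `_eq_zero_iff_exists` (`F (ℓ+n) n y = 0 ↔ ∃ x, F ℓ (ℓ+n) x = y`: the sequence
`0 → W_ℓ → W_{ℓ+n} → W_n → 0` is exact), and the SCALARS `_apply_apply_of_le` (`F ℓ (ℓ+n) (F (ℓ+n) ℓ w) = p^n • w`),
`EisensteinCoeff.Twisted.pow_smul_eq_zero` (`p^j • W_j = 0`, file `IwasawaAlgebraEisensteinTorsionExactProofs`).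
Inputs: iterated kernels `ker (W_a → W_b) = p^b W_a` (from the one-step exactness, by induction) and the TORSION
EXACTNESS `W_a[p^b] = p^{a−b} W_a` of free levels (`IwasawaAlgebraEisensteinTorsionExactProofs`; false for a general
exact tower, e.g. the constant tower `ℤ/p`), the division construction (`GaloisRepresentations/DiscreteGaloisModuleDivision`).
§3: the curve (`M_k = E[p^k]`, `t` any lifts of `×p`) unconditionally.

References: [Howard2004HeegnerKolyvagin] §1.1 (Quot(T), Def. 1.1.3), §1.6, §2.2 (arXiv 1202.6340 p. 5, p. 12);
[MazurRubinMemoirs2004] §1.1; [SerreGaloisCohomology1997] I §2.2. BSD is not proved by any of this.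
-/

noncomputable section

open scoped TensorProduct ContRepresentation
open Function Field IsLocalRing

/-! ## §1 Iterated transitions of the `M`-tower and the two-index family of the Eisenstein tower -/

namespace Literature.NumberTheory.EllipticCurves.ZpExtension

open Literature.NumberTheory.GaloisRepresentations IwasawaAlgebra
open Literature.NumberTheory.GaloisRepresentations.DiscreteGaloisModule (divIntertwining divIntertwining_apply_apply
  divIntertwining_injective)

section MTower

variable {K : Type} [Field K]
  {M : ℕ → Type} [∀ k, AddCommGroup (M k)] [∀ k, TopologicalSpace (M k)] [∀ k, DiscreteTopology (M k)]
  (ρ : ∀ k, DiscreteGaloisModule K (M k))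
  (t : ∀ k, (ρ (k + 1)).toContRepresentation →ⁱL (ρ k).toContRepresentation)

/-- **The iterated transition `t^{a−b} : M_a → M_b`** (`b ≤ a`), `t_b ∘ t_{b+1} ∘ ⋯ ∘ t_{a−1}` (for `M_k = E[p^k]` with
`×p`: multiplication by `p^{a−b}`). [cite: Howard2004HeegnerKolyvagin, §1.1 (Quot(T)) and §2.2] -/
def transitionIter {a b : ℕ} (h : b ≤ a) : (ρ a).toContRepresentation →ⁱL (ρ b).toContRepresentation :=
  Nat.leRecOn (C := fun k ↦ (ρ k).toContRepresentation →ⁱL (ρ b).toContRepresentation) h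
    (fun {k} (g : (ρ k).toContRepresentation →ⁱL (ρ b).toContRepresentation) ↦ g.comp (t k))
    ContIntertwiningMap.id

/-- `t^0 = id`. [cite: Howard2004HeegnerKolyvagin, §1.1] -/
theorem transitionIter_self (b : ℕ) (x : M b) : transitionIter ρ t (le_refl b) x = x := by
  have h : transitionIter ρ t (le_refl b) = ContIntertwiningMap.id :=
    Nat.leRecOn_self (C := fun k ↦ (ρ k).toContRepresentation →ⁱL (ρ b).toContRepresentation) _
  rw [h]; rfl

/-- `t^{a+1−b} = t^{a−b} ∘ t_a`. [cite: Howard2004HeegnerKolyvagin, §1.1] -/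
theorem transitionIter_succ {a b : ℕ} (h : b ≤ a) (x : M (a + 1)) :
    transitionIter ρ t (h.trans (Nat.le_succ a)) x = transitionIter ρ t h (t a x) := by
  have hs : transitionIter ρ t (h.trans (Nat.le_succ a)) = (transitionIter ρ t h).comp (t a) :=
    Nat.leRecOn_succ (C := fun k ↦ (ρ k).toContRepresentation →ⁱL (ρ b).toContRepresentation) h _
  rw [hs]; rfl

/-- `t^{1} = t_b`. [cite: Howard2004HeegnerKolyvagin, §1.1] -/
theorem transitionIter_succ_self (b : ℕ) : transitionIter ρ t (Nat.le_succ b) = t b :=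
  ContIntertwiningMap.toFun_injective (funext fun x ↦ by
    change transitionIter ρ t ((le_refl b).trans (Nat.le_succ b)) x = t b x
    rw [transitionIter_succ ρ t (le_refl b), transitionIter_self])

/-- Transitivity `t^{b−c} ∘ t^{a−b} = t^{a−c}`. [cite: Howard2004HeegnerKolyvagin, §1.1] -/
theorem transitionIter_transitionIter {a b c : ℕ} (hcb : c ≤ b) (hba : b ≤ a) (x : M a) :
    transitionIter ρ t hcb (transitionIter ρ t hba x) = transitionIter ρ t (hcb.trans hba) x := by
  induction a, hba using Nat.le_induction with
  | base => rw [transitionIter_self]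
  | succ a hba ih =>
    rw [transitionIter_succ ρ t hba, ih, ← transitionIter_succ ρ t (hcb.trans hba)]

/-- The iterated transitions are surjective. [cite: Howard2004HeegnerKolyvagin, §2.2] -/
theorem transitionIter_surjective (ht : ∀ k, Function.Surjective (t k)) {a b : ℕ} (h : b ≤ a) : Function.Surjective (transitionIter ρ t h) := by
  induction a, h using Nat.le_induction with
  | base => intro x; exact ⟨x, transitionIter_self ρ t b x⟩
  | succ a h ih =>
    intro x
    obtain ⟨y, rfl⟩ := ih x
    obtain ⟨z, rfl⟩ := ht a y
    exact ⟨z, transitionIter_succ ρ t h z⟩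

variable {p : ℕ}

/-- **The kernel of `t^{a−b} : M_a → M_b` is `p^b M_a`**, for a tower with `ker t_k = p^k M_{k+1}` and levels killed
by `p^k` (induction on `a`). [cite: Howard2004HeegnerKolyvagin, §2.2] -/
theorem transitionIter_eq_zero_iff (ht : ∀ k, Function.Surjective (t k))
    (hkt : ∀ k (x : M (k + 1)), t k x = 0 ↔ ∃ y : M (k + 1), x = ((p : ℤ) ^ k) • y)
    (hkill : ∀ k (x : M k), ((p : ℤ) ^ k) • x = 0) {a b : ℕ} (h : b ≤ a) (x : M a) :
    transitionIter ρ t h x = 0 ↔ ∃ y : M a, x = ((p : ℤ) ^ b) • y := by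
  induction a, h using Nat.le_induction with
  | base =>
    rw [transitionIter_self]
    constructor
    · rintro rfl; exact ⟨0, (smul_zero _).symm⟩
    · rintro ⟨y, rfl⟩; exact hkill b y
  | succ a h ih =>
    rw [transitionIter_succ ρ t h, ih]
    constructor
    · rintro ⟨y', hy'⟩
      obtain ⟨y₀, rfl⟩ := ht a y'
      have h0 : t a (x - ((p : ℤ) ^ b) • y₀) = 0 := by rw [map_sub, map_zsmul, hy', sub_self]
      obtain ⟨z, hz⟩ := (hkt a _).1 h0
      refine ⟨y₀ + ((p : ℤ) ^ (a - b)) • z, ?_⟩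
      rw [smul_add, smul_smul, ← pow_add, Nat.add_sub_cancel' h, ← hz, add_sub_cancel]
    · rintro ⟨y, rfl⟩
      exact ⟨t a y, map_zsmul (t a) _ y⟩

end MTower

section Transfer

variable {K : Type} [Field K] {p : ℕ} [hp : Fact p.Prime] (κ : ZpExtension K p)
  {M : ℕ → Type} [∀ k, AddCommGroup (M k)] [∀ k, TopologicalSpace (M k)] [∀ k, DiscreteTopology (M k)]
  (ρ : ∀ k, DiscreteGaloisModule K (M k))
  (t : ∀ k, (ρ (k + 1)).toContRepresentation →ⁱL (ρ k).toContRepresentation)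
  {m : ℕ} (hm : 1 ≤ m)

/-- **The iterated reduction `W_a ↠ W_b` of the Eisenstein tower** (`b ≤ a`): `c ⊗ x ↦ (c mod p^b) ⊗ t^{a−b} x`.
[cite: Howard2004HeegnerKolyvagin, §1.6 and §2.2 (T_𝔮/p^a → T_𝔮/p^b)] -/
def eisensteinTwistReduceIter {a b : ℕ} (h : b ≤ a) :
    (κ.eisensteinTwist (ρ a) hm a).toContRepresentation →ⁱL (κ.eisensteinTwist (ρ b) hm b).toContRepresentation :=
  κ.eisensteinTwistReduce hm h (transitionIter ρ t h)

/-- The iterated reductions are surjective. [cite: Howard2004HeegnerKolyvagin, §2.2] -/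
theorem eisensteinTwistReduceIter_surjective (ht : ∀ k, Function.Surjective (t k)) {a b : ℕ} (h : b ≤ a) :
    Function.Surjective (κ.eisensteinTwistReduceIter ρ t hm h) :=
  κ.eisensteinTwistReduce_surjective hm h _ (transitionIter_surjective ρ t ht h)

/-- **The kernel of `W_a ↠ W_b` is `p^b W_a`.** [cite: Howard2004HeegnerKolyvagin, §1.6 and §2.2] -/
theorem eisensteinTwistReduceIter_eq_zero_iff (ht : ∀ k, Function.Surjective (t k))
    (hkt : ∀ k (x : M (k + 1)), t k x = 0 ↔ ∃ y : M (k + 1), x = ((p : ℤ) ^ k) • y)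
    (hkill : ∀ k (x : M k), ((p : ℤ) ^ k) • x = 0) {a b : ℕ} (h : b ≤ a) (x : EisensteinCoeff.Twisted p m a (M a)) :
    κ.eisensteinTwistReduceIter ρ t hm h x = 0 ↔ ∃ y : EisensteinCoeff.Twisted p m a (M a), x = p ^ b • y := by
  have h1 := eisensteinTwistReduceLinear_eq_zero_iff (p := p) (m := m) h
    (transitionIter ρ t h).toContinuousLinearMap.toLinearMap (transitionIter_surjective ρ t ht h)
    (fun x ↦ transitionIter_eq_zero_iff ρ t ht hkt hkill h x) x
  refine h1.trans ⟨fun ⟨y, hy⟩ ↦ ⟨y, ?_⟩, fun ⟨y, hy⟩ ↦ ⟨y, ?_⟩⟩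
  · rw [hy, ← natCast_zsmul, Nat.cast_pow]
  · rw [hy, ← natCast_zsmul, Nat.cast_pow]

/-- `red_{a→a} = id`. [cite: Howard2004HeegnerKolyvagin, §1.1] -/
theorem eisensteinTwistReduceIter_self (a : ℕ) (w : EisensteinCoeff.Twisted p m a (M a)) :
    κ.eisensteinTwistReduceIter ρ t hm (le_refl a) w = w := by
  induction w using EisensteinCoeff.Twisted.induction_on with
  | zero => exact map_zero _
  | tmul c x =>
    obtain ⟨f, rfl⟩ := Ideal.Quotient.mk_surjective c
    change κ.eisensteinTwistReduce hm (le_refl a) (transitionIter ρ t (le_refl a)) _ = _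
    rw [eisensteinTwistReduce_tmul, EisensteinCoeff.reduce_mk]
    exact congrArg _ (transitionIter_self ρ t a x)
  | add x y hx hy => rw [map_add, hx, hy]

/-- **The iterated reductions compose**: `red_{b→c} ∘ red_{a→b} = red_{a→c}` (`c ≤ b ≤ a`).
[cite: Howard2004HeegnerKolyvagin, §1.1 (Quot(T) is a category)] -/
theorem eisensteinTwistReduceIter_comp {a b c : ℕ} (hcb : c ≤ b) (hba : b ≤ a)
    (w : EisensteinCoeff.Twisted p m a (M a)) :
    κ.eisensteinTwistReduceIter ρ t hm hcb (κ.eisensteinTwistReduceIter ρ t hm hba w) =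
      κ.eisensteinTwistReduceIter ρ t hm (hcb.trans hba) w := by
  induction w using EisensteinCoeff.Twisted.induction_on with
  | zero => simp only [map_zero]
  | tmul c₀ x =>
    obtain ⟨f, rfl⟩ := Ideal.Quotient.mk_surjective c₀
    change κ.eisensteinTwistReduce hm hcb _ (κ.eisensteinTwistReduce hm hba _ _) = κ.eisensteinTwistReduce hm _ _ _
    rw [eisensteinTwistReduce_tmul, EisensteinCoeff.reduce_mk, eisensteinTwistReduce_tmul, EisensteinCoeff.reduce_mk,
      eisensteinTwistReduce_tmul, EisensteinCoeff.reduce_mk]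
    exact congrArg _ (transitionIter_transitionIter ρ t hcb hba x)
  | add x y hx hy => rw [map_add, map_add, hx, hy, map_add]

/-- `red_{j+1 → j}` is the tower's transition `eisensteinTwistReduce hm (Nat.le_succ j) (t j)`.
[cite: Howard2004HeegnerKolyvagin, §2.2] -/
theorem eisensteinTwistReduceIter_succ_self (j : ℕ) :
    κ.eisensteinTwistReduceIter ρ t hm (Nat.le_succ j) = κ.eisensteinTwistReduce hm (Nat.le_succ j) (t j) := by
  unfold eisensteinTwistReduceIter
  rw [transitionIter_succ_self]

/-- `p^{b−a}` kills the kernel of `red_{b→a}` (`a ≤ b`): the kernel is `p^a W_b` and `p^b W_b = 0`.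
[cite: Howard2004HeegnerKolyvagin, §2.2] -/
theorem pow_smul_eq_zero_of_eisensteinTwistReduceIter_eq_zero (ht : ∀ k, Function.Surjective (t k))
    (hkt : ∀ k (x : M (k + 1)), t k x = 0 ↔ ∃ y : M (k + 1), x = ((p : ℤ) ^ k) • y)
    (hkill : ∀ k (x : M k), ((p : ℤ) ^ k) • x = 0) {a b : ℕ} (h : a ≤ b)
    (x : EisensteinCoeff.Twisted p m b (M b)) (hx : κ.eisensteinTwistReduceIter ρ t hm h x = 0) :
    p ^ (b - a) • x = 0 := by
  obtain ⟨y, rfl⟩ := (κ.eisensteinTwistReduceIter_eq_zero_iff ρ t hm ht hkt hkill h x).1 hx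
  rw [smul_smul, ← pow_add, Nat.sub_add_cancel h]
  exact EisensteinCoeff.Twisted.pow_smul_eq_zero m b y

/-- **The two-index family of the Eisenstein tower** `F a b : W_a → W_b`: the iterated reduction for `b ≤ a`, the
division `×p^{b−a}` for `a < b` (the unique additive `g` with `g ∘ red_{b→a} = p^{b−a} • id`). All the maps
`T_𝔮/p^a → T_𝔮/p^b` of `Quot(T_𝔮)` induced by `1` and by `p^{b−a}`.
[cite: Howard2004HeegnerKolyvagin, Def. 1.1.3 (arXiv Def. 2.1.3) and §2.2] -/
def eisensteinTwistTransfer (ht : ∀ k, Function.Surjective (t k))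
    (hkt : ∀ k (x : M (k + 1)), t k x = 0 ↔ ∃ y : M (k + 1), x = ((p : ℤ) ^ k) • y)
    (hkill : ∀ k (x : M k), ((p : ℤ) ^ k) • x = 0) (a b : ℕ) :
    (κ.eisensteinTwist (ρ a) hm a).toContRepresentation →ⁱL (κ.eisensteinTwist (ρ b) hm b).toContRepresentation :=
  if h : b ≤ a then κ.eisensteinTwistReduceIter ρ t hm h
  else divIntertwining (κ.eisensteinTwistReduceIter ρ t hm (le_of_not_ge h))
    (κ.eisensteinTwistReduceIter_surjective ρ t hm ht (le_of_not_ge h)) (p ^ (b - a))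
    (κ.pow_smul_eq_zero_of_eisensteinTwistReduceIter_eq_zero ρ t hm ht hkt hkill (le_of_not_ge h))

/-- Unfolding for `b ≤ a`: the iterated reduction. [cite: Howard2004HeegnerKolyvagin, §2.2] -/
theorem eisensteinTwistTransfer_of_le (ht : ∀ k, Function.Surjective (t k))
    (hkt : ∀ k (x : M (k + 1)), t k x = 0 ↔ ∃ y : M (k + 1), x = ((p : ℤ) ^ k) • y)
    (hkill : ∀ k (x : M k), ((p : ℤ) ^ k) • x = 0) {a b : ℕ} (h : b ≤ a) :
    κ.eisensteinTwistTransfer ρ t hm ht hkt hkill a b = κ.eisensteinTwistReduceIter ρ t hm h := by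
  unfold eisensteinTwistTransfer; rw [dif_pos h]

/-- Unfolding for `a < b`: the division `×p^{b−a}` along `red_{b→a}`. [cite: Howard2004HeegnerKolyvagin, Def. 1.1.3] -/
theorem eisensteinTwistTransfer_of_lt (ht : ∀ k, Function.Surjective (t k))
    (hkt : ∀ k (x : M (k + 1)), t k x = 0 ↔ ∃ y : M (k + 1), x = ((p : ℤ) ^ k) • y)
    (hkill : ∀ k (x : M k), ((p : ℤ) ^ k) • x = 0) {a b : ℕ} (h : a < b) :
    κ.eisensteinTwistTransfer ρ t hm ht hkt hkill a b =
      divIntertwining (κ.eisensteinTwistReduceIter ρ t hm h.le)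
        (κ.eisensteinTwistReduceIter_surjective ρ t hm ht h.le) (p ^ (b - a))
        (κ.pow_smul_eq_zero_of_eisensteinTwistReduceIter_eq_zero ρ t hm ht hkt hkill h.le) := by
  unfold eisensteinTwistTransfer; rw [dif_neg (not_le.2 h)]

/-- **`F (j+1) j` IS the tower's transition** `eisensteinTwistReduce hm (Nat.le_succ j) (t j)` (so `H¹` of its
localisation is D1's `eisensteinLocalReduce`). [cite: Howard2004HeegnerKolyvagin, §2.2] -/
theorem eisensteinTwistTransfer_succ_self (ht : ∀ k, Function.Surjective (t k))
    (hkt : ∀ k (x : M (k + 1)), t k x = 0 ↔ ∃ y : M (k + 1), x = ((p : ℤ) ^ k) • y)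
    (hkill : ∀ k (x : M k), ((p : ℤ) ^ k) • x = 0) (j : ℕ) :
    κ.eisensteinTwistTransfer ρ t hm ht hkt hkill (j + 1) j = κ.eisensteinTwistReduce hm (Nat.le_succ j) (t j) := by
  rw [eisensteinTwistTransfer_of_le _ _ _ _ _ _ _ (Nat.le_succ j), eisensteinTwistReduceIter_succ_self]

/-- `hid`: `F a a = id`. [cite: Howard2004HeegnerKolyvagin, §1.1] -/
theorem eisensteinTwistTransfer_self (ht : ∀ k, Function.Surjective (t k))
    (hkt : ∀ k (x : M (k + 1)), t k x = 0 ↔ ∃ y : M (k + 1), x = ((p : ℤ) ^ k) • y)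
    (hkill : ∀ k (x : M k), ((p : ℤ) ^ k) • x = 0) (a : ℕ) (w : EisensteinCoeff.Twisted p m a (M a)) :
    κ.eisensteinTwistTransfer ρ t hm ht hkt hkill a a w = w := by
  rw [eisensteinTwistTransfer_of_le _ _ _ _ _ _ _ (le_refl a), eisensteinTwistReduceIter_self]

/-- `hcomp`: the reductions compose, `F b c (F a b w) = F a c w` for `c ≤ b ≤ a`.
[cite: Howard2004HeegnerKolyvagin, §1.1 (Quot(T))] -/
theorem eisensteinTwistTransfer_comp (ht : ∀ k, Function.Surjective (t k))
    (hkt : ∀ k (x : M (k + 1)), t k x = 0 ↔ ∃ y : M (k + 1), x = ((p : ℤ) ^ k) • y)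
    (hkill : ∀ k (x : M k), ((p : ℤ) ^ k) • x = 0) {a b c : ℕ} (hcb : c ≤ b) (hba : b ≤ a)
    (w : EisensteinCoeff.Twisted p m a (M a)) :
    κ.eisensteinTwistTransfer ρ t hm ht hkt hkill b c (κ.eisensteinTwistTransfer ρ t hm ht hkt hkill a b w) =
      κ.eisensteinTwistTransfer ρ t hm ht hkt hkill a c w := by
  rw [eisensteinTwistTransfer_of_le _ _ _ _ _ _ _ hcb, eisensteinTwistTransfer_of_le _ _ _ _ _ _ _ hba,
    eisensteinTwistTransfer_of_le _ _ _ _ _ _ _ (hcb.trans hba), eisensteinTwistReduceIter_comp]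

/-- **`F a b (F b a w) = p^{b−a} • w`** for `a ≤ b` (`×p^{b−a}` after reducing is multiplication by `p^{b−a}`).
[cite: Howard2004HeegnerKolyvagin, Def. 1.1.3] -/
theorem eisensteinTwistTransfer_apply_apply (ht : ∀ k, Function.Surjective (t k))
    (hkt : ∀ k (x : M (k + 1)), t k x = 0 ↔ ∃ y : M (k + 1), x = ((p : ℤ) ^ k) • y)
    (hkill : ∀ k (x : M k), ((p : ℤ) ^ k) • x = 0) {a b : ℕ} (hab : a ≤ b)
    (w : EisensteinCoeff.Twisted p m b (M b)) :
    κ.eisensteinTwistTransfer ρ t hm ht hkt hkill a b (κ.eisensteinTwistTransfer ρ t hm ht hkt hkill b a w) =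
      p ^ (b - a) • w := by
  rcases hab.eq_or_lt with rfl | hlt
  · rw [Nat.sub_self, pow_zero, one_smul]
    exact (κ.eisensteinTwistTransfer_self ρ t hm ht hkt hkill a _).trans
      (κ.eisensteinTwistTransfer_self ρ t hm ht hkt hkill a w)
  · rw [eisensteinTwistTransfer_of_lt _ _ _ _ _ _ _ hlt, eisensteinTwistTransfer_of_le _ _ _ _ _ _ _ hlt.le,
      divIntertwining_apply_apply]

/-- `hpow`: **`F ℓ (ℓ+n) (F (ℓ+n) ℓ w) = p^n • w`.** [cite: Howard2004HeegnerKolyvagin, Def. 1.1.3] -/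
theorem eisensteinTwistTransfer_apply_apply_of_le (ht : ∀ k, Function.Surjective (t k))
    (hkt : ∀ k (x : M (k + 1)), t k x = 0 ↔ ∃ y : M (k + 1), x = ((p : ℤ) ^ k) • y)
    (hkill : ∀ k (x : M k), ((p : ℤ) ^ k) • x = 0) (ℓ n : ℕ) (w : EisensteinCoeff.Twisted p m (ℓ + n) (M (ℓ + n))) :
    κ.eisensteinTwistTransfer ρ t hm ht hkt hkill ℓ (ℓ + n)
        (κ.eisensteinTwistTransfer ρ t hm ht hkt hkill (ℓ + n) ℓ w) = p ^ n • w := by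
  rw [κ.eisensteinTwistTransfer_apply_apply ρ t hm ht hkt hkill (Nat.le_add_right ℓ n), Nat.add_sub_cancel_left]

/-- `hsurj`: **the reduction `F (ℓ+n) n : W_{ℓ+n} → W_n` is surjective.** [cite: Howard2004HeegnerKolyvagin, §2.2] -/
theorem eisensteinTwistTransfer_surjective_of_le (ht : ∀ k, Function.Surjective (t k))
    (hkt : ∀ k (x : M (k + 1)), t k x = 0 ↔ ∃ y : M (k + 1), x = ((p : ℤ) ^ k) • y)
    (hkill : ∀ k (x : M k), ((p : ℤ) ^ k) • x = 0) {a b : ℕ} (h : b ≤ a) :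
    Function.Surjective (κ.eisensteinTwistTransfer ρ t hm ht hkt hkill a b) := by
  rw [eisensteinTwistTransfer_of_le _ _ _ _ _ _ _ h]
  exact κ.eisensteinTwistReduceIter_surjective ρ t hm ht h

/-- The kernel of a reduction `F a b` (`b ≤ a`) is `p^b W_a`. [cite: Howard2004HeegnerKolyvagin, §1.6 and §2.2] -/
theorem eisensteinTwistTransfer_eq_zero_iff_of_le (ht : ∀ k, Function.Surjective (t k))
    (hkt : ∀ k (x : M (k + 1)), t k x = 0 ↔ ∃ y : M (k + 1), x = ((p : ℤ) ^ k) • y)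
    (hkill : ∀ k (x : M k), ((p : ℤ) ^ k) • x = 0) {a b : ℕ} (h : b ≤ a) (x : EisensteinCoeff.Twisted p m a (M a)) :
    κ.eisensteinTwistTransfer ρ t hm ht hkt hkill a b x = 0 ↔
      ∃ y : EisensteinCoeff.Twisted p m a (M a), x = p ^ b • y := by
  rw [eisensteinTwistTransfer_of_le _ _ _ _ _ _ _ h]
  exact κ.eisensteinTwistReduceIter_eq_zero_iff ρ t hm ht hkt hkill h x

/-- `hsq`: **`×p^{b−a}` commutes with one reduction step**: `F a b (F (a+1) a w) = F (b+1) b (F (a+1) (b+1) w)` for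
`a ≤ b`. [cite: Howard2004HeegnerKolyvagin, Def. 1.1.3 (morphisms of Quot(T) commute with the reductions)] -/
theorem eisensteinTwistTransfer_sq (ht : ∀ k, Function.Surjective (t k))
    (hkt : ∀ k (x : M (k + 1)), t k x = 0 ↔ ∃ y : M (k + 1), x = ((p : ℤ) ^ k) • y)
    (hkill : ∀ k (x : M k), ((p : ℤ) ^ k) • x = 0) {a b : ℕ} (hab : a ≤ b) (w : EisensteinCoeff.Twisted p m (a + 1) (M (a + 1))) :
    κ.eisensteinTwistTransfer ρ t hm ht hkt hkill a b (κ.eisensteinTwistTransfer ρ t hm ht hkt hkill (a + 1) a w) =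
      κ.eisensteinTwistTransfer ρ t hm ht hkt hkill (b + 1) b
        (κ.eisensteinTwistTransfer ρ t hm ht hkt hkill (a + 1) (b + 1) w) := by
  have h1 : a + 1 ≤ b + 1 := Nat.succ_le_succ hab
  obtain ⟨u, rfl⟩ := κ.eisensteinTwistTransfer_surjective_of_le ρ t hm ht hkt hkill h1 w
  rw [κ.eisensteinTwistTransfer_comp ρ t hm ht hkt hkill (Nat.le_succ a) h1,
    ← κ.eisensteinTwistTransfer_comp ρ t hm ht hkt hkill hab (Nat.le_succ b),
    κ.eisensteinTwistTransfer_apply_apply ρ t hm ht hkt hkill hab,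
    κ.eisensteinTwistTransfer_apply_apply ρ t hm ht hkt hkill h1, map_nsmul,
    show b + 1 - (a + 1) = b - a by omega]

/-- `hinj`: **the division `F ℓ (ℓ+n) : W_ℓ → W_{ℓ+n}` is injective** (torsion exactness of the free level `W_{ℓ+n}`:
`W_{ℓ+n}[p^n] = p^ℓ W_{ℓ+n} = ker red_{ℓ+n→ℓ}`). [cite: Howard2004HeegnerKolyvagin, Def. 1.1.3 and §2.2] -/
theorem eisensteinTwistTransfer_injective_of_le (ht : ∀ k, Function.Surjective (t k))
    (hkt : ∀ k (x : M (k + 1)), t k x = 0 ↔ ∃ y : M (k + 1), x = ((p : ℤ) ^ k) • y)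
    (hkill : ∀ k (x : M k), ((p : ℤ) ^ k) • x = 0) {ι : ℕ → Type} [∀ k, Fintype (ι k)]
    (e : ∀ k, M k ≃+ (ι k → ZMod (p ^ k))) (ℓ n : ℕ) :
    Function.Injective (κ.eisensteinTwistTransfer ρ t hm ht hkt hkill ℓ (ℓ + n)) := by
  rcases Nat.eq_zero_or_pos n with rfl | hn
  · intro x y hxy
    rwa [Nat.add_zero, eisensteinTwistTransfer_self, eisensteinTwistTransfer_self] at hxy
  · have hlt : ℓ < ℓ + n := Nat.lt_add_of_pos_right hn
    rw [eisensteinTwistTransfer_of_lt _ _ _ _ _ _ _ hlt]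
    refine divIntertwining_injective _ _ _ _ fun x hx ↦ ?_
    rw [Nat.add_sub_cancel_left] at hx
    obtain ⟨y, rfl⟩ := EisensteinCoeff.Twisted.exists_eq_pow_smul_of_pow_smul_eq_zero hm (Nat.le_add_left n ℓ)
      (e (ℓ + n)) x hx
    rw [Nat.add_sub_cancel, map_nsmul]
    exact EisensteinCoeff.Twisted.pow_smul_eq_zero m ℓ _

/-- `hex`: **exactness in the middle of `0 → W_ℓ → W_{ℓ+n} → W_n → 0`**: `F (ℓ+n) n y = 0 ↔ ∃ x, F ℓ (ℓ+n) x = y`.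
[cite: Howard2004HeegnerKolyvagin, §1.6 and §2.2 (0 → T/p^ℓ → T/p^{ℓ+n} → T/p^n → 0)] -/
theorem eisensteinTwistTransfer_eq_zero_iff_exists (ht : ∀ k, Function.Surjective (t k))
    (hkt : ∀ k (x : M (k + 1)), t k x = 0 ↔ ∃ y : M (k + 1), x = ((p : ℤ) ^ k) • y)
    (hkill : ∀ k (x : M k), ((p : ℤ) ^ k) • x = 0) (ℓ n : ℕ) (y : EisensteinCoeff.Twisted p m (ℓ + n) (M (ℓ + n))) :
    κ.eisensteinTwistTransfer ρ t hm ht hkt hkill (ℓ + n) n y = 0 ↔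
      ∃ x, κ.eisensteinTwistTransfer ρ t hm ht hkt hkill ℓ (ℓ + n) x = y := by
  rw [κ.eisensteinTwistTransfer_eq_zero_iff_of_le ρ t hm ht hkt hkill (Nat.le_add_left n ℓ)]
  constructor
  · rintro ⟨u, rfl⟩
    exact ⟨κ.eisensteinTwistTransfer ρ t hm ht hkt hkill (ℓ + n) ℓ u,
      κ.eisensteinTwistTransfer_apply_apply_of_le ρ t hm ht hkt hkill ℓ n u⟩
  · rintro ⟨x, rfl⟩
    obtain ⟨u, rfl⟩ := κ.eisensteinTwistTransfer_surjective_of_le ρ t hm ht hkt hkill (Nat.le_add_right ℓ n) x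
    exact ⟨u, κ.eisensteinTwistTransfer_apply_apply_of_le ρ t hm ht hkt hkill ℓ n u⟩

end Transfer

end Literature.NumberTheory.EllipticCurves.ZpExtension

/-! ## §2 The curve: `M_k = E[p^k]` with the multiplication-by-`p` transitions -/

namespace WeierstrassCurve

open Literature.NumberTheory.EllipticCurves Literature.NumberTheory.GaloisRepresentations
open Literature.NumberTheory.EllipticCurves.IwasawaAlgebra

variable {K : Type} [Field K] (W : WeierstrassCurve K) [W.IsElliptic] {p : ℕ} [hp : Fact p.Prime]
  (κ : ZpExtension K p) {m : ℕ} (hm : 1 ≤ m)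
  (t : ∀ k, (W.torsionGaloisModule ((p : ℤ) ^ (k + 1))).toContRepresentation →ⁱL
    (W.torsionGaloisModule ((p : ℤ) ^ k)).toContRepresentation)

/-- **The hypotheses `ht`, `hkt`, `hkill` of the two-index family hold for `E[p^•]` with any lifts `t k` of `×p`**
(divisibility of `E(K̄)` and `ker(×p) ∩ E[p^{k+1}] = p^k E[p^{k+1}]`, tree `torsionGaloisModule_lift_surjective` /
`torsionGaloisModule_lift_eq_zero_iff`). [cite: SilvermanAEC2009, §VIII.2 and Cor. III.6.4] [cite: Howard2004HeegnerKolyvagin, §2.2] -/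
theorem torsionGaloisModule_transition_hypotheses (ht : ∀ k (P : geomTorsion W ((p : ℤ) ^ (k + 1))),
      ((t k P : geomTorsion W ((p : ℤ) ^ k)) : geomPoints W) = (p : ℤ) • (P : geomPoints W)) :
    (∀ k, Function.Surjective (t k)) ∧
      (∀ k (x : geomTorsion W ((p : ℤ) ^ (k + 1))), t k x = 0 ↔
        ∃ y : geomTorsion W ((p : ℤ) ^ (k + 1)), x = ((p : ℤ) ^ k) • y) ∧
      ∀ k (x : geomTorsion W ((p : ℤ) ^ k)), ((p : ℤ) ^ k) • x = 0 :=
  ⟨fun k ↦ W.torsionGaloisModule_lift_surjective k (t k) (ht k),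
    fun k x ↦ W.torsionGaloisModule_lift_eq_zero_iff k (t k) (ht k) x, fun _ x ↦ Subtype.ext (by
      rw [AddSubgroupClass.coe_zsmul, ZeroMemClass.coe_zero]
      exact (mem_geomTorsion_iff W _ _).1 x.2)⟩

/-- **The two-index family of the curve's Eisenstein tower `E[p^k] ⊗ A_{m,k}(ψ)`** (no hypotheses left: `t` any
lifts of `×p`). [cite: Howard2004HeegnerKolyvagin, Def. 1.1.3 and §2.2] -/
def eisensteinTwistTorsionTransfer (ht : ∀ k (P : geomTorsion W ((p : ℤ) ^ (k + 1))),
      ((t k P : geomTorsion W ((p : ℤ) ^ k)) : geomPoints W) = (p : ℤ) • (P : geomPoints W)) (a b : ℕ) :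
    (κ.eisensteinTwist (W.torsionGaloisModule ((p : ℤ) ^ a)) hm a).toContRepresentation →ⁱL
      (κ.eisensteinTwist (W.torsionGaloisModule ((p : ℤ) ^ b)) hm b).toContRepresentation :=
  κ.eisensteinTwistTransfer (fun k ↦ W.torsionGaloisModule ((p : ℤ) ^ k)) t hm
    (W.torsionGaloisModule_transition_hypotheses t ht).1 (W.torsionGaloisModule_transition_hypotheses t ht).2.1
    (W.torsionGaloisModule_transition_hypotheses t ht).2.2 a b

/-- Unfolding: the curve's family is the generic one. [cite: Howard2004HeegnerKolyvagin, §2.2] -/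
theorem eisensteinTwistTorsionTransfer_eq (ht : ∀ k (P : geomTorsion W ((p : ℤ) ^ (k + 1))),
      ((t k P : geomTorsion W ((p : ℤ) ^ k)) : geomPoints W) = (p : ℤ) • (P : geomPoints W)) (a b : ℕ) :
    W.eisensteinTwistTorsionTransfer κ hm t ht a b =
      κ.eisensteinTwistTransfer (fun k ↦ W.torsionGaloisModule ((p : ℤ) ^ k)) t hm
        (W.torsionGaloisModule_transition_hypotheses t ht).1 (W.torsionGaloisModule_transition_hypotheses t ht).2.1
        (W.torsionGaloisModule_transition_hypotheses t ht).2.2 a b := rfl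

/-- **`hinj` for the curve, unconditionally**: the division `W_ℓ → W_{ℓ+n}` is injective (`E[p^k] ≅ (ℤ/p^k)²`,
`char K = 0`). [cite: SilvermanAEC2009, Cor. III.6.4(b)] [cite: Howard2004HeegnerKolyvagin, Def. 1.1.3 and §2.2] -/
theorem eisensteinTwistTorsionTransfer_injective [CharZero K] (ht : ∀ k (P : geomTorsion W ((p : ℤ) ^ (k + 1))),
      ((t k P : geomTorsion W ((p : ℤ) ^ k)) : geomPoints W) = (p : ℤ) • (P : geomPoints W)) (ℓ n : ℕ) :
    Function.Injective (W.eisensteinTwistTorsionTransfer κ hm t ht ℓ (ℓ + n)) := by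
  have hpK : (p : K) ≠ 0 := Nat.cast_ne_zero.2 hp.out.ne_zero
  exact κ.eisensteinTwistTransfer_injective_of_le (fun k ↦ W.torsionGaloisModule ((p : ℤ) ^ k)) t hm _ _ _
    (fun k ↦ (W.nonempty_geomTorsion_prime_pow_addEquiv_fin_two hpK k).some) ℓ n

end WeierstrassCurve

end
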